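import Mathlib
import HarnessLib
import Literature.Geometry.DiscreteGeometry.BondGraph
import Literature.Geometry.DiscreteGeometry.KissingPatterns
import Summits.AtomisticToContinuum.Crystallization.Theorems.PricedLinkCensusSoftLayerPropagationBasics
import Summits.AtomisticToContinuum.Crystallization.Theorems.PricedLinkCensusSoftLayerPropagationStubDevelopHO
import Summits.AtomisticToContinuum.Crystallization.Theorems.PricedLinkCensusSoftLayerPropagationStubMetricOcta
import Summits.AtomisticToContinuum.Crystallization.Theorems.PricedLinkCensusSoftLayerPropagationStubMetricBipyramid
import Summits.AtomisticToContinuum.Crystallization.Theorems.PricedLinkCensusSoftLayerPropagationStubMetricScaled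
import Summits.AtomisticToContinuum.Crystallization.Theorems.PricedLinkCensusSoftLayerPropagationStubShadowTransition
import Summits.AtomisticToContinuum.Crystallization.Theorems.PricedLinkCensusSoftLayerPropagationStubChartAssembly
import Summits.AtomisticToContinuum.Crystallization.Theorems.PricedLinkCensusSoftLayerPropagationHXApex
import Summits.AtomisticToContinuum.Crystallization.Theorems.PricedLinkCensusSoftLayerPropagationHXLensB
import Summits.AtomisticToContinuum.Crystallization.Theorems.PricedLinkCensusSoftLayerPropagationHXSite
import Summits.AtomisticToContinuum.Crystallization.Theorems.PricedLinkCensusSoftLayerPropagationHXHcpPattern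
import Summits.AtomisticToContinuum.Crystallization.Theorems.PricedLinkCensusSoftLayerPropagationHXHcpVertical
import Summits.AtomisticToContinuum.Crystallization.Theorems.PricedLinkCensusSoftLayerPropagationHXHcpCases

/-!
# Local no-merge at an HCP-type site (crux `SoftLayerPropagation`, line `Sketch`, registered stub `develop_HX_hcp`)

Route `PricedLinkCensus`, crux `SoftLayerPropagation` (stmt-AtomisticToContinuum-14233), line `Sketch`.
Worker file for the registered stub `develop_HX_hcp` (signature verbatim from the registered skeleton
`Cruxes/SoftLayerPropagation/Lines/Sketch.lean`): hypothesis `HX` of the ordered development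
`Theorems.develop_step` at an HCP-type site `x`.  With `u = m p_u`, `k = m p_k` read in the chart of
`x` (integer model `hcpInt`, the anticuboctahedron scaled by `3`), the non-contact pair `(p_u, p_k)`
falls into one of five classes (`hcpInt_noncontact_cases`, integer squared distances
`36, 48, 54, 66, 72`, i.e. `2, 8/3, 3, 11/3, 4` at unit scale):

* `36`, square diagonal: as at an FCC-type site — the far apex `z` of the coned square exists
  (`hx_far_apex`); either `t = z` (and a corner of the square is the common neighbour) or the lens
  lemma `hx_lens_square_dist` is contradicted;
* `48`, vertical pair `(u_θ, l_θ)`: the bipyramid on the common face `x b b'`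
  (`Theorems.metric_bipyramid_dist`) and the lens lemma `hxh_lens_vertical_dist` (four pairwise
  separated points cannot all be bonded to both apices) — vacuous;
* `54`: the hexagon-type class, `hcp_hexagon_case` applied to the pair in the order supplied by
  `hcpInt_hexagon` — vacuous;
* `66`, skew pair: `hcp_skew_case` — vacuous;
* `72`, antipodal: the charts put `y_u, y_k` within `nn_x/4` of `y_x ± nn_x A p_u`
  (`hx_antipodal`) — vacuous.

Everything is read at the one scale `ℓ = nn_x/(1+η)` with edge ratio `(1+η)³ ≤ 33/32` (`…HXSite`).
-/

noncomputable section

namespace Summit.AtomisticToContinuum.Crystallization.Theorems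

open Literature.Geometry.DiscreteGeometry

/-- **develop_HX_hcp** (registered stub; LOCAL NO-MERGE at an HCP-type site).  As `develop_HX_fcc`
with the anticuboctahedral label classes `√2, √(8/3), √3, √(11/3), 2` (`√(8/3)`: the vertical pair
through a triangle — `Theorems.metric_bipyramid(_unique)`). -/
theorem develop_HX_hcp :
    ∀ η : ℝ, 0 < η → η ≤ 1 / 100 →
      ∀ (N : ℕ) (y : Fin N → EuclideanSpace ℝ (Fin 3)) (x : Fin N),
        0 < Literature.Geometry.DiscreteGeometry.nearestDist y x →
        (∀ j : Fin N, dist (y x) (y j) ≤ 5 / 2 * Literature.Geometry.DiscreteGeometry.nearestDist y x →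
          Literature.Geometry.DiscreteGeometry.IsChargeFree η y j) →
        (∀ j : Fin N, dist (y x) (y j) ≤ 5 / 2 * Literature.Geometry.DiscreteGeometry.nearestDist y x →
          ∃ (P : Finset (EuclideanSpace ℝ (Fin 3)))
            (A : EuclideanSpace ℝ (Fin 3) →ₗᵢ[ℝ] EuclideanSpace ℝ (Fin 3))
            (m : EuclideanSpace ℝ (Fin 3) → Fin N),
            (P = Literature.Geometry.DiscreteGeometry.fccKissingPattern ∨
              P = Literature.Geometry.DiscreteGeometry.hcpKissingPattern) ∧
            (∀ p ∈ P, (Literature.Geometry.DiscreteGeometry.bondGraph η y).Adj j (m p) ∧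
              dist (y (m p)) (y j + Literature.Geometry.DiscreteGeometry.nearestDist y j • A p) ≤
                Literature.Geometry.DiscreteGeometry.nearestDist y j / 4) ∧
            (∀ p ∈ P, ∀ q ∈ P, m p = m q → p = q) ∧
            (∀ p ∈ P, ∀ q ∈ P,
              ((Literature.Geometry.DiscreteGeometry.bondGraph η y).Adj (m p) (m q) ↔ dist p q = 1)) ∧
            (∀ l, (Literature.Geometry.DiscreteGeometry.bondGraph η y).Adj j l → ∃ p ∈ P, m p = l)) →
        ∀ (A : EuclideanSpace ℝ (Fin 3) →ₗᵢ[ℝ] EuclideanSpace ℝ (Fin 3)) (m : EuclideanSpace ℝ (Fin 3) → Fin N),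
          ((Literature.Geometry.DiscreteGeometry.hcpKissingPattern = Literature.Geometry.DiscreteGeometry.fccKissingPattern ∨
            Literature.Geometry.DiscreteGeometry.hcpKissingPattern = Literature.Geometry.DiscreteGeometry.hcpKissingPattern) ∧
          (∀ p ∈ Literature.Geometry.DiscreteGeometry.hcpKissingPattern, (Literature.Geometry.DiscreteGeometry.bondGraph η y).Adj x (m p) ∧
            dist (y (m p)) (y x + Literature.Geometry.DiscreteGeometry.nearestDist y x • A p) ≤
              Literature.Geometry.DiscreteGeometry.nearestDist y x / 4) ∧
          (∀ p ∈ Literature.Geometry.DiscreteGeometry.hcpKissingPattern, ∀ q ∈ Literature.Geometry.DiscreteGeometry.hcpKissingPattern, m p = m q → p = q) ∧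
          (∀ p ∈ Literature.Geometry.DiscreteGeometry.hcpKissingPattern, ∀ q ∈ Literature.Geometry.DiscreteGeometry.hcpKissingPattern,
            ((Literature.Geometry.DiscreteGeometry.bondGraph η y).Adj (m p) (m q) ↔ dist p q = 1)) ∧
          (∀ l, (Literature.Geometry.DiscreteGeometry.bondGraph η y).Adj x l → ∃ p ∈ Literature.Geometry.DiscreteGeometry.hcpKissingPattern, m p = l)) →
        ∀ u k t : Fin N, (Literature.Geometry.DiscreteGeometry.bondGraph η y).Adj x u → (Literature.Geometry.DiscreteGeometry.bondGraph η y).Adj x k → ¬ (Literature.Geometry.DiscreteGeometry.bondGraph η y).Adj u k → u ≠ k →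
          ¬ (Literature.Geometry.DiscreteGeometry.bondGraph η y).Adj x t → x ≠ t → (Literature.Geometry.DiscreteGeometry.bondGraph η y).Adj t u → (Literature.Geometry.DiscreteGeometry.bondGraph η y).Adj t k →
          ∃ c : Fin N, (Literature.Geometry.DiscreteGeometry.bondGraph η y).Adj x c ∧ (Literature.Geometry.DiscreteGeometry.bondGraph η y).Adj u c ∧ (Literature.Geometry.DiscreteGeometry.bondGraph η y).Adj k c ∧ (Literature.Geometry.DiscreteGeometry.bondGraph η y).Adj t c := by
  intro η hη0 hη1 N y x hnn _hCF charts A m hx u k t hxu hxk hnuk hneuk hnxt hnext htu htk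
  obtain ⟨-, C2, C3, C4, C5⟩ := hx
  have hη : (0 : ℝ) ≤ η := hη0.le
  have hρ : (0 : ℝ) < 1 + η := by linarith
  /- the scale `ℓ = nn_x/(1+η)` and the edge ratio `(1+η)³ = 1 + ε` -/
  set ℓ := nearestDist y x / (1 + η) with hℓ
  have hℓpos : 0 < ℓ := div_pos hnn hρ
  set ε := (1 + η) ^ 3 - 1 with hε
  have hcube : (1 + η) ^ 3 = 1 + 3 * η + 3 * η ^ 2 + η ^ 3 := by ring
  have hη2 : η ^ 2 ≤ η * (1 / 100) := by nlinarith
  have hη3 : η ^ 3 ≤ η ^ 2 * (1 / 100) := by nlinarith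
  have hε0 : 0 ≤ ε := by rw [hε, hcube]; nlinarith
  have hε1 : ε ≤ 1 / 32 := by rw [hε, hcube]; nlinarith
  have hpow : (1 + η) ^ 3 = 1 + ε := by rw [hε]; ring
  have sx : ℓ ≤ nearestDist y x ∧ nearestDist y x ≤ (1 + η) ^ 2 * ℓ := hx_self_scale hη x
  have star : ∀ {v : Fin N}, (bondGraph η y).Adj x v →
      ℓ ≤ nearestDist y v ∧ nearestDist y v ≤ (1 + η) ^ 2 * ℓ := fun h => hx_star_scale hη h
  have up : ∀ {v : Fin N}, ℓ ≤ nearestDist y v → ℓ ≤ (1 + η) * nearestDist y v := fun h =>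
    h.trans (le_mul_of_one_le_left ((hℓpos.le).trans h) (by linarith))
  have E : ∀ {j l : Fin N}, (bondGraph η y).Adj j l → ℓ ≤ nearestDist y j →
      nearestDist y j ≤ (1 + η) ^ 2 * ℓ →
      (ℓ ≤ dist (y j) (y l) ∧ dist (y j) (y l) ≤ (1 + ε) * ℓ) ∧
        (ℓ ≤ dist (y l) (y j) ∧ dist (y l) (y j) ≤ (1 + ε) * ℓ) := by
    intro j l h h1 h2
    have := hx_edge hη h h1 h2
    rwa [hpow] at this
  -- `t` against `u`, `k`, `x`
  have st : ℓ ≤ (1 + η) * nearestDist y t := hx_shell_scale hη htu.symm (star hxu).1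
  have dtu := (E htu.symm (star hxu).1 (star hxu).2).2
  have dtk := (E htk.symm (star hxk).1 (star hxk).2).2
  have dtx : ℓ ≤ dist (y t) (y x) := (hx_nonbond hη hnext.symm (fun h => hnxt h.symm) st (up sx.1)).1
  have duk : ℓ ≤ dist (y u) (y k) := (hx_nonbond hη hneuk hnuk (up (star hxu).1) (up (star hxk).1)).1
  /- the labels of `u`, `k` in the chart of `x` -/
  have h18 : (18 : ℕ) ≠ 0 := by norm_num
  have memS : ∀ v ∈ hcpInt, ((Real.sqrt (18 : ℕ))⁻¹ • intVec v : EuclideanSpace ℝ (Fin 3)) ∈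
      hcpKissingPattern := fun v hv => Finset.mem_image_of_mem _ hv
  have Z4 : ∀ v ∈ hcpInt, ∀ w ∈ hcpInt,
      ((bondGraph η y).Adj (m ((Real.sqrt (18 : ℕ))⁻¹ • intVec v)) (m ((Real.sqrt (18 : ℕ))⁻¹ • intVec w)) ↔
        sqNormInt (v - w) = (18 : ℕ)) := fun v hv w hw => by
    rw [C4 _ (memS v hv) _ (memS w hw), dist_scaled_intVec_eq_one_iff h18]
  have D1 : ∀ v w : Fin 3 → ℤ, sqNormInt (v - w) = (18 : ℕ) →
      dist ((Real.sqrt (18 : ℕ))⁻¹ • intVec v : EuclideanSpace ℝ (Fin 3)) ((Real.sqrt (18 : ℕ))⁻¹ • intVec w) = 1 :=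
    fun v w h => (dist_scaled_intVec_eq_one_iff h18 v w).2 h
  obtain ⟨pu, hpu, mpu⟩ := C5 u hxu
  obtain ⟨pk, hpk, mpk⟩ := C5 k hxk
  obtain ⟨vu, hvu, rfl⟩ := Finset.mem_image.1 hpu
  obtain ⟨vk, hvk, rfl⟩ := Finset.mem_image.1 hpk
  have hneq : vu ≠ vk := by
    intro h; apply hneuk; rw [← mpu, ← mpk, h]
  have hneq' : ((Real.sqrt (18 : ℕ))⁻¹ • intVec vu : EuclideanSpace ℝ (Fin 3)) ≠ (Real.sqrt (18 : ℕ))⁻¹ • intVec vk :=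
    fun h => hneq (scaledPattern_map_injective h18 h)
  have hnc : sqNormInt (vu - vk) ≠ (18 : ℕ) := by
    intro h; apply hnuk; rw [← mpu, ← mpk]; exact (Z4 vu hvu vk hvk).2 h
  have hnc' : dist ((Real.sqrt (18 : ℕ))⁻¹ • intVec vu : EuclideanSpace ℝ (Fin 3)) ((Real.sqrt (18 : ℕ))⁻¹ • intVec vk) ≠ 1 :=
    fun h => hnc ((dist_scaled_intVec_eq_one_iff h18 vu vk).1 h)
  have hncr : sqNormInt (vk - vu) ≠ (18 : ℕ) := by
    intro h; apply hnuk; rw [← mpu, ← mpk]; exact ((Z4 vk hvk vu hvu).2 h).symm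
  have htu' : (bondGraph η y).Adj t (m ((Real.sqrt (18 : ℕ))⁻¹ • intVec vu)) := by rw [mpu]; exact htu
  have htk' : (bondGraph η y).Adj t (m ((Real.sqrt (18 : ℕ))⁻¹ • intVec vk)) := by rw [mpk]; exact htk
  rcases hcpInt_noncontact_cases vu hvu vk hvk hneq hnc with h36 | h48 | h54 | h66 | h72
  · /- SQUARE DIAGONAL -/
    obtain ⟨va, hva, hua2, hak2, vb, hvb, hkb2, hbu2, hneab, hnab⟩ := hcpInt_square vu hvu vk hvk h36
    have hxa : (bondGraph η y).Adj x (m ((Real.sqrt (18 : ℕ))⁻¹ • intVec va)) := (C2 _ (memS va hva)).1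
    have hxb : (bondGraph η y).Adj x (m ((Real.sqrt (18 : ℕ))⁻¹ • intVec vb)) := (C2 _ (memS vb hvb)).1
    have hua : (bondGraph η y).Adj u (m ((Real.sqrt (18 : ℕ))⁻¹ • intVec va)) := by
      rw [← mpu]; exact (Z4 vu hvu va hva).2 hua2
    have hak : (bondGraph η y).Adj (m ((Real.sqrt (18 : ℕ))⁻¹ • intVec va)) k := by
      rw [← mpk]; exact (Z4 va hva vk hvk).2 hak2
    have hkb : (bondGraph η y).Adj k (m ((Real.sqrt (18 : ℕ))⁻¹ • intVec vb)) := by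
      rw [← mpk]; exact (Z4 vk hvk vb hvb).2 hkb2
    have hbu : (bondGraph η y).Adj (m ((Real.sqrt (18 : ℕ))⁻¹ • intVec vb)) u := by
      rw [← mpu]; exact (Z4 vb hvb vu hvu).2 hbu2
    have hnab' : ¬ (bondGraph η y).Adj (m ((Real.sqrt (18 : ℕ))⁻¹ • intVec va)) (m ((Real.sqrt (18 : ℕ))⁻¹ • intVec vb)) := fun h => hnab ((Z4 va hva vb hvb).1 h)
    have hneab' : m ((Real.sqrt (18 : ℕ))⁻¹ • intVec va) ≠ m ((Real.sqrt (18 : ℕ))⁻¹ • intVec vb) :=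
      fun h => hneab (scaledPattern_map_injective h18 (C3 _ (memS va hva) _ (memS vb hvb) h))
    generalize ha : m ((Real.sqrt (18 : ℕ))⁻¹ • intVec va) = a at *
    generalize hb : m ((Real.sqrt (18 : ℕ))⁻¹ • intVec vb) = b at *
    -- the far apex
    obtain ⟨z, hzu, hza, hzk, hzb, hnxz, hnexz⟩ := hx_far_apex η hη (by linarith) N y x hnn charts
      hcpKissingPattern A m (Or.inr rfl) C2 C3 C4 C5 _ (memS vu hvu) _ (memS va hva) _ (memS vk hvk)
      _ (memS vb hvb) (D1 _ _ hua2) (D1 _ _ hak2) (D1 _ _ hkb2) (D1 _ _ hbu2) hneq' hnc'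
      (fun h => hneab (scaledPattern_map_injective h18 h))
      (fun h => hnab ((dist_scaled_intVec_eq_one_iff h18 va vb).1 h))
    rw [mpu] at hzu; rw [mpk] at hzk; rw [ha] at hza; rw [hb] at hzb
    by_cases htz : t = z
    · subst htz
      exact ⟨a, hxa, hua, hak.symm, hza.symm⟩
    · exfalso
      have sz : ℓ ≤ (1 + η) * nearestDist y z := hx_shell_scale hη hzu (star hxu).1
      have hta : a ≠ t := fun h => hnxt (h ▸ hxa)
      have htb : b ≠ t := fun h => hnxt (h ▸ hxb)
      exact hx_lens_square_dist ε ℓ hε0 hε1 hℓpos (y u) (y k) (y a) (y b) (y x) (y z) (y t)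
        (E hua (star hxu).1 (star hxu).2).1.1 (E hua (star hxu).1 (star hxu).2).1.2
        (E hbu.symm (star hxu).1 (star hxu).2).1.1 (E hbu.symm (star hxu).1 (star hxu).2).1.2
        (E hak.symm (star hxk).1 (star hxk).2).1.1 (E hak.symm (star hxk).1 (star hxk).2).1.2
        (E hkb (star hxk).1 (star hxk).2).1.1 (E hkb (star hxk).1 (star hxk).2).1.2
        (E hxa sx.1 sx.2).2.1 (E hxa sx.1 sx.2).2.2
        (E hza (star hxa).1 (star hxa).2).1.1 (E hza (star hxa).1 (star hxa).2).1.2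
        (E hxb sx.1 sx.2).2.1 (E hxb sx.1 sx.2).2.2
        (E hzb (star hxb).1 (star hxb).2).1.1 (E hzb (star hxb).1 (star hxb).2).1.2
        (E hxu sx.1 sx.2).1.1 (E hxu sx.1 sx.2).1.2 (E hxk sx.1 sx.2).1.1 (E hxk sx.1 sx.2).1.2
        (E hzu (star hxu).1 (star hxu).2).2.1 (E hzu (star hxu).1 (star hxu).2).2.2
        (E hzk (star hxk).1 (star hxk).2).2.1 (E hzk (star hxk).1 (star hxk).2).2.2
        duk (hx_nonbond hη hneab' hnab' (up (star hxa).1) (up (star hxb).1)).1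
        (hx_nonbond hη hnexz hnxz (up sx.1) sz).1
        dtu.1 dtu.2 dtk.1 dtk.2 dtx (hx_distinct hta (star hxa).1).2 (hx_distinct htb (star hxb).1).2
        (hx_soft_floor hη hη1 (Ne.symm htz) sz)
  · /- VERTICAL PAIR: vacuous -/
    exfalso
    obtain ⟨vb, hvb, hbu2, hbk2, vc, hvc, hcu2, hck2, hbc2⟩ := hcpInt_vertical vu hvu vk hvk h48
    have hxb : (bondGraph η y).Adj x (m ((Real.sqrt (18 : ℕ))⁻¹ • intVec vb)) := (C2 _ (memS vb hvb)).1
    have hxc : (bondGraph η y).Adj x (m ((Real.sqrt (18 : ℕ))⁻¹ • intVec vc)) := (C2 _ (memS vc hvc)).1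
    have hbu : (bondGraph η y).Adj (m ((Real.sqrt (18 : ℕ))⁻¹ • intVec vb)) u := by
      rw [← mpu]; exact (Z4 vb hvb vu hvu).2 hbu2
    have hbk : (bondGraph η y).Adj (m ((Real.sqrt (18 : ℕ))⁻¹ • intVec vb)) k := by
      rw [← mpk]; exact (Z4 vb hvb vk hvk).2 hbk2
    have hcu : (bondGraph η y).Adj (m ((Real.sqrt (18 : ℕ))⁻¹ • intVec vc)) u := by
      rw [← mpu]; exact (Z4 vc hvc vu hvu).2 hcu2
    have hck : (bondGraph η y).Adj (m ((Real.sqrt (18 : ℕ))⁻¹ • intVec vc)) k := by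
      rw [← mpk]; exact (Z4 vc hvc vk hvk).2 hck2
    have hbc : (bondGraph η y).Adj (m ((Real.sqrt (18 : ℕ))⁻¹ • intVec vb)) (m ((Real.sqrt (18 : ℕ))⁻¹ • intVec vc)) := (Z4 vb hvb vc hvc).2 hbc2
    generalize hb : m ((Real.sqrt (18 : ℕ))⁻¹ • intVec vb) = b at *
    generalize hc : m ((Real.sqrt (18 : ℕ))⁻¹ • intVec vc) = c at *
    -- the bipyramid on the face `x b c` with apices `u, k`
    obtain ⟨-, vlo, vhi⟩ := metric_bipyramid_dist ε ℓ hε0 (hε1.trans (by norm_num)) hℓpos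
      (y x) (y b) (y c) (y u) (y k)
      (E hxb sx.1 sx.2).1.1 (E hxb sx.1 sx.2).1.2 (E hxc sx.1 sx.2).1.1 (E hxc sx.1 sx.2).1.2
      (E hbc (star hxb).1 (star hxb).2).1.1 (E hbc (star hxb).1 (star hxb).2).1.2
      (E hxu sx.1 sx.2).2.1 (E hxu sx.1 sx.2).2.2
      (E hbu (star hxb).1 (star hxb).2).2.1 (E hbu (star hxb).1 (star hxb).2).2.2
      (E hcu (star hxc).1 (star hxc).2).2.1 (E hcu (star hxc).1 (star hxc).2).2.2
      (E hxk sx.1 sx.2).2.1 (E hxk sx.1 sx.2).2.2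
      (E hbk (star hxb).1 (star hxb).2).2.1 (E hbk (star hxb).1 (star hxb).2).2.2
      (E hck (star hxc).1 (star hxc).2).2.1 (E hck (star hxc).1 (star hxc).2).2.2
      duk
    have htb : b ≠ t := fun h => hnxt (h ▸ hxb)
    have htc : c ≠ t := fun h => hnxt (h ▸ hxc)
    exact hxh_lens_vertical_dist ε ℓ hε0 hε1 hℓpos (y u) (y k) (y x) (y b) (y c) (y t)
      (E hxu sx.1 sx.2).1.1 (E hxu sx.1 sx.2).1.2 (E hxk sx.1 sx.2).1.1 (E hxk sx.1 sx.2).1.2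
      (E hbu (star hxb).1 (star hxb).2).1.1 (E hbu (star hxb).1 (star hxb).2).1.2
      (E hbk (star hxb).1 (star hxb).2).1.1 (E hbk (star hxb).1 (star hxb).2).1.2
      (E hcu (star hxc).1 (star hxc).2).1.1 (E hcu (star hxc).1 (star hxc).2).1.2
      (E hck (star hxc).1 (star hxc).2).1.1 (E hck (star hxc).1 (star hxc).2).1.2
      dtu.1 dtu.2 dtk.1 dtk.2 vlo vhi
      (E hxb sx.1 sx.2).1.1 (E hxc sx.1 sx.2).1.1 (E hbc (star hxb).1 (star hxb).2).1.1
      dtx (hx_distinct htb (star hxb).1).2 (hx_distinct htc (star hxc).1).2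
  · /- HEXAGON-TYPE: vacuous -/
    exfalso
    rcases hcpInt_hexagon vu hvu vk hvk h54 with hstr | hstr
    · exact hcp_hexagon_case η hη0 hη1 N y x hnn charts A m C2 C3 C4 C5 vu hvu vk hvk hneq hnc hstr t
        hnxt hnext htu' htk'
    · exact hcp_hexagon_case η hη0 hη1 N y x hnn charts A m C2 C3 C4 C5 vk hvk vu hvu hneq.symm hncr
        hstr t hnxt hnext htk' htu'
  · /- SKEW PAIR: vacuous -/
    exfalso
    exact hcp_skew_case η hη0 hη1 N y x hnn charts A m C2 C3 C4 C5 vu hvu vk hvk hneq hnc h66 t hnxt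
      hnext htu' htk'
  · /- ANTIPODAL: vacuous -/
    exfalso
    have hk' := hcpInt_antipodal vu hvu vk hvk h72
    have eneg : ((Real.sqrt (18 : ℕ))⁻¹ • intVec vk : EuclideanSpace ℝ (Fin 3)) =
        -((Real.sqrt (18 : ℕ))⁻¹ • intVec vu) := by
      rw [hk', ← smul_neg]
      congr 1
      ext i
      simp [intVec]
    have cu := (C2 _ (memS vu hvu)).2
    have ck := (C2 _ (memS vk hvk)).2
    rw [mpu] at cu
    rw [mpk, eneg, map_neg, smul_neg, ← sub_eq_add_neg] at ck
    have he : ‖A ((Real.sqrt (18 : ℕ))⁻¹ • intVec vu)‖ = 1 := by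
      rw [A.norm_map]; exact norm_eq_one_of_mem_hcpKissingPattern (memS vu hvu)
    have dtu' : dist (y t) (y u) ≤ 26 / 25 * nearestDist y x := by
      have h1 := dist_le_of_adj hρ.le htu.symm
      rw [dist_comm] at h1
      have h2 := (star hxu).2
      have h3 : (1 + η) ^ 2 * ℓ = (1 + η) * nearestDist y x := by rw [hℓ]; field_simp
      nlinarith [dist_nonneg (x := y t) (y := y u)]
    have dtk' : dist (y t) (y k) ≤ 26 / 25 * nearestDist y x := by
      have h1 := dist_le_of_adj hρ.le htk.symm
      rw [dist_comm] at h1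
      have h2 := (star hxk).2
      have h3 : (1 + η) ^ 2 * ℓ = (1 + η) * nearestDist y x := by rw [hℓ]; field_simp
      nlinarith [dist_nonneg (x := y t) (y := y k)]
    have hlt := hx_antipodal (nearestDist y x) (y x) (A ((Real.sqrt (18 : ℕ))⁻¹ • intVec vu)) (y u) (y k) (y t)
      hnn he cu ck dtu' dtk'
    exact absurd (nearestDist_le_dist y (j := x) (k := t) hnext.symm) (not_le.2 hlt)

end Summit.AtomisticToContinuum.Crystallization.Theorems

end
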